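import Mathlib
import Literature.NumberTheory.Sieve.Maynard2016IntervalPrimes
import HarnessLib

/-!
# Maynard 2016: `ω_{m,q}(p) ≤ 2k`

Topic `Literature/NumberTheory/Sieve`. J. Maynard, *Large gaps between primes*, Ann. of Math. (2)
183 (2016), 915–933 = arXiv:1408.5110, §5 display (5.1)
(`ω_{m,q}(p) = #{1 ≤ n ≤ p : n + h_i q ≡ 0 or m(n + h_i q) ≡ 1 (mod p) for some i}`) and §6,
proof of Lemma 7 after (6.23): "`ω_{m,q}(p) ≤ 2k` for all `p`" (each `i` contributes at most the
two classes `n ≡ −h_i q` and `n ≡ m⁻¹ − h_i q`).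

PROVED here (no named facts): `eq_of_modEq_of_mem_Icc` (two integers of `[1, p]` congruent mod `p`
are equal), `card_filter_dvd_add_le_one`, `card_filter_mul_add_modEq_one_le_one`, and
`omegaMQ_le_two_mul : ω_{m,q}(p) ≤ 2k`.

## References

* J. Maynard, *Large gaps between primes*, Ann. of Math. (2) 183 (2016), 915–933; arXiv:1408.5110,
  §5 (5.1) and Lemma 7 (proof, «ω_{m,q}(p) ≤ 2k for all p»). [Maynard2016LargeGaps]
-/

open Filter Finset
open scoped Topology

namespace Literature.NumberTheory.Sieve

namespace Maynard2016

/-- Two integers of `[1, p]` that are congruent modulo `p` are equal. [folklore] -/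
private theorem eq_of_modEq_of_mem_Icc {p a b : ℕ} (ha : a ∈ Finset.Icc 1 p)
    (hb : b ∈ Finset.Icc 1 p) (h : a ≡ b [MOD p]) : a = b := by
  simp only [Finset.mem_Icc] at ha hb
  rcases le_total a b with hab | hab
  · have h1 := (Nat.modEq_iff_dvd' hab).1 h
    have h2 : b - a = 0 := Nat.eq_zero_of_dvd_of_lt h1 (by omega)
    omega
  · have h1 := (Nat.modEq_iff_dvd' hab).1 h.symm
    have h2 : a - b = 0 := Nat.eq_zero_of_dvd_of_lt h1 (by omega)
    omega

/-- `#{1 ≤ n ≤ p : p ∣ n + c} ≤ 1`. [cite: Maynard2016LargeGaps, Lemma 7 (proof, «ω_{m,q}(p) ≤ 2k»)] -/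
theorem card_filter_dvd_add_le_one (p c : ℕ) :
    ((Finset.Icc 1 p).filter (fun n => p ∣ n + c)).card ≤ 1 := by
  refine Finset.card_le_one.2 fun a ha b hb => ?_
  rw [Finset.mem_filter] at ha hb
  refine eq_of_modEq_of_mem_Icc ha.1 hb.1 ?_
  have h : a + c ≡ b + c [MOD p] :=
    ((Nat.modEq_zero_iff_dvd.2 ha.2).trans (Nat.modEq_zero_iff_dvd.2 hb.2).symm)
  exact Nat.ModEq.add_right_cancel' c h

/-- `#{1 ≤ n ≤ p : m(n + c) ≡ 1 (mod p)} ≤ 1` for a prime `p`. [cite: Maynard2016LargeGaps, Lemma 7 (proof, «ω_{m,q}(p) ≤ 2k»)] -/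
theorem card_filter_mul_add_modEq_one_le_one {p : ℕ} (hp : p.Prime) (m c : ℕ) :
    ((Finset.Icc 1 p).filter (fun n => m * (n + c) ≡ 1 [MOD p])).card ≤ 1 := by
  refine Finset.card_le_one.2 fun a ha b hb => ?_
  rw [Finset.mem_filter] at ha hb
  refine eq_of_modEq_of_mem_Icc ha.1 hb.1 ?_
  have h : m * (a + c) ≡ m * (b + c) [MOD p] := ha.2.trans hb.2.symm
  by_cases hpm : p ∣ m
  · -- then `m(a+c) ≡ 0`, contradicting `≡ 1`
    exfalso
    have h0 : m * (a + c) ≡ 0 [MOD p] := Nat.modEq_zero_iff_dvd.2 (hpm.mul_right _)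
    have h1 : 1 ≡ 0 [MOD p] := ha.2.symm.trans h0
    have : p ∣ 1 := (Nat.modEq_zero_iff_dvd.1 h1)
    exact hp.one_lt.ne' (Nat.dvd_one.1 this)
  · have hcop : Nat.gcd p m = 1 := (Nat.Prime.coprime_iff_not_dvd hp).2 hpm
    exact Nat.ModEq.add_right_cancel' c (Nat.ModEq.cancel_left_of_coprime hcop h)

/-- **`ω_{m,q}(p) ≤ 2k`** for every prime `p`. [cite: Maynard2016LargeGaps, Lemma 7 (proof, «ω_{m,q}(p) ≤ 2k for all p»)] -/
theorem omegaMQ_le_two_mul (k x m q : ℕ) {p : ℕ} (hp : p.Prime) : omegaMQ k x m q p ≤ 2 * k := by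
  classical
  unfold omegaMQ
  have hsub : (Finset.Icc 1 p).filter (fun n => ∃ i : Fin k,
      p ∣ n + hTuple k x i * q ∨ m * (n + hTuple k x i * q) ≡ 1 [MOD p]) ⊆
      Finset.univ.biUnion (fun i : Fin k =>
        (Finset.Icc 1 p).filter (fun n => p ∣ n + hTuple k x i * q) ∪
          (Finset.Icc 1 p).filter (fun n => m * (n + hTuple k x i * q) ≡ 1 [MOD p])) := by
    intro n hn
    rw [Finset.mem_filter] at hn
    obtain ⟨hn1, i, hi⟩ := hn
    refine Finset.mem_biUnion.2 ⟨i, Finset.mem_univ _, ?_⟩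
    rcases hi with h | h
    · exact Finset.mem_union_left _ (Finset.mem_filter.2 ⟨hn1, h⟩)
    · exact Finset.mem_union_right _ (Finset.mem_filter.2 ⟨hn1, h⟩)
  refine (Finset.card_le_card hsub).trans (Finset.card_biUnion_le.trans ?_)
  calc ∑ i : Fin k, ((Finset.Icc 1 p).filter (fun n => p ∣ n + hTuple k x i * q) ∪
          (Finset.Icc 1 p).filter (fun n => m * (n + hTuple k x i * q) ≡ 1 [MOD p])).card
      ≤ ∑ _i : Fin k, 2 := by
        refine Finset.sum_le_sum fun i _ => (Finset.card_union_le _ _).trans ?_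
        have h1 := card_filter_dvd_add_le_one p (hTuple k x i * q)
        have h2 := card_filter_mul_add_modEq_one_le_one hp m (hTuple k x i * q)
        omega
    _ = 2 * k := by simp [mul_comm]

/-- Every factor `1 − ω_{m,q}(p)/p` of `𝔖_{m,q}` with `p > 2k` is positive. [cite: Maynard2016LargeGaps, §5 display (5.2)] -/
theorem one_sub_omegaMQ_div_pos (k x m q : ℕ) {p : ℕ} (hp : p.Prime) (hpk : 2 * k < p) :
    0 < 1 - (omegaMQ k x m q p : ℝ) / p := by
  have hp0 : (0 : ℝ) < p := by exact_mod_cast hp.pos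
  rw [sub_pos, div_lt_one hp0]
  exact_mod_cast lt_of_le_of_lt (omegaMQ_le_two_mul k x m q hp) hpk

end Maynard2016

end Literature.NumberTheory.Sieve
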